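import Mathlib
import Summits.Ventures.DiscreteObjects.Mahler.FewnomialHeightBound
import Summits.Ventures.DiscreteObjects.Mahler.NonreciprocalStructure
import Summits.Ventures.DiscreteObjects.Mahler.NonreciprocalMeasureBound
import Summits.Ventures.DiscreteObjects.Mahler.TrinomialSmythBound
import Summits.Ventures.DiscreteObjects.Mahler.GraeffeIdentity

/-!
# The shape of a sub-Lehmer pentanomial (venture `DiscreteObjects`, target L)

Cell `pub-namedobj`, seat `pub-namedobj-mahler-g26`. Framing: lottery ticket; floor = certified bounds/negative ranges.

By the cell's `SparseSubLehmer` (kernel form of [Dobrowolski2006, Prop. 2]) a sub-Lehmer integer polynomial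
(`1 < M(P) < M(ℓ) = 1.17628…`) has at least five nonzero coefficients.  This file pins down the first open sparse
class: **a sub-Lehmer polynomial with exactly five nonzero coefficients is**
`P = ± x^j · Q`, `Q = x^{2m} + a x^{m+i} + c x^m + a x^{m-i} + 1`, `0 < i < m`, `1 ≤ |a| ≤ 4`, `1 ≤ |c| ≤ 7`,
with `Q` itself sub-Lehmer (`subLehmer_pentanomial_shape`).  Ingredients, all in the kernel: a sub-Lehmer `Q` with
`Q(0) ≠ 0` is reciprocal or antireciprocal (`reverse_eq_or_of_subLehmer`, from `M ≥ (1+√17)/4` for nonreciprocal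
polynomials); `|lead Q| ≤ M(Q) < 2`; the support of an (anti)reciprocal polynomial is symmetric under `e ↦ deg - e`,
and a symmetric 5-set is `{0, m-i, m, m+i, 2m}` with the middle coefficient forcing the sign `+` (reciprocal); the
coefficient bounds are the Akhtari–Vaaler bounds `|c_j| ≤ binom(4, j) · M(Q)` (`FewnomialHeightBound`:
`binom(4,1) · 1.17629 < 5`, `binom(4,2) · 1.17629 < 8`).  So Lehmer's problem for pentanomials is the two-exponent
family `x^{2m} + a(x^{m+i} + x^{m-i}) + c x^m + 1` over the finite coefficient box `(a, c) ∈ ([-4,4]∖{0}) × ([-7,7]∖{0})`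
— on the unit circle `|Q(e^{iθ})| = |2 cos(mθ) + 2a cos(iθ) + c|`.  Nearest print: El-Serafy–McKee (Canad. Math. Bull.
2025) settle the length-5 class (`|a| = |c| = 1`) for house `≥ 1.01`; 'Short Salem polynomials' (arXiv:2605.19013)
classify the length-5 Salem polynomials.  A structural constraint on the Lehmer ticket; no new bound on `M`.
-/

namespace Summit.Ventures.DiscreteObjects.Mahler

open Polynomial

/-- **Support classification, five terms.**  A monic `P ∈ ℤ[X]` of degree `n ≥ 1` with exactly five nonzero
coefficients and `P_{n-e} = ε P_e` (`ε = ±1`) is `x^{2m} + a x^{m+i} + c x^m + a x^{m-i} + 1` with `0 < i < m`,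
`a, c ≠ 0` (and `ε = 1`); the exponents `m - i`, `m` have ranks `1`, `2` in the support. -/
theorem pentanomial_eq_of_monic_reciprocal {P : ℤ[X]} {ε : ℤ} (hε : ε = 1 ∨ ε = -1) (hmon : P.Monic)
    (hdeg : 0 < P.natDegree) (hrel : ∀ i ≤ P.natDegree, P.coeff (P.natDegree - i) = ε * P.coeff i)
    (hcard : P.support.card = 5) :
    ∃ m i : ℕ, ∃ a c : ℤ, 0 < i ∧ i < m ∧ a ≠ 0 ∧ c ≠ 0 ∧ P.natDegree = 2 * m ∧
      P = X ^ (2 * m) + C a * X ^ (m + i) + C c * X ^ m + C a * X ^ (m - i) + 1 ∧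
      P.coeff (m - i) = a ∧ P.coeff m = c ∧
      (P.support.filter (· < m - i)).card = 1 ∧ (P.support.filter (· < m)).card = 2 := by
  classical
  set n := P.natDegree with hn
  have hεε : ε * ε = 1 := by rcases hε with h | h <;> simp [h]
  have hε0 : ε ≠ 0 := by rcases hε with h | h <;> simp [h]
  have hcn : P.coeff n = 1 := hmon.coeff_natDegree
  have hc0 : P.coeff 0 = ε := by
    have h := hrel 0 (Nat.zero_le _)
    rw [Nat.sub_zero, hcn] at h
    linear_combination (-ε) * h + (-(P.coeff 0)) * hεε
  set S := (P.support.erase n).erase 0 with hS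
  have hmemS : ∀ k, k ∈ S ↔ k ≠ 0 ∧ k ≠ n ∧ P.coeff k ≠ 0 := by
    intro k; simp only [hS, Finset.mem_erase, mem_support_iff]
  have hScard : S.card = 3 := by
    have h1 : n ∈ P.support := mem_support_iff.mpr (by rw [hcn]; exact one_ne_zero)
    have h2 : 0 ∈ P.support.erase n :=
      Finset.mem_erase.mpr ⟨by omega, mem_support_iff.mpr (by rw [hc0]; exact hε0)⟩
    have e1 : S.card = (P.support.erase n).card - 1 := Finset.card_erase_of_mem h2
    have e2 : (P.support.erase n).card = P.support.card - 1 := Finset.card_erase_of_mem h1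
    omega
  have hzero : ∀ k, k ∉ S → k ≠ 0 → k ≠ n → P.coeff k = 0 := by
    intro k hk hk0 hkn
    by_contra h
    exact hk ((hmemS k).mpr ⟨hk0, hkn, h⟩)
  have hsymm : ∀ k ∈ S, n - k ∈ S := by
    intro k hk
    obtain ⟨hk0, hkn, hkc⟩ := (hmemS k).mp hk
    have hkle : k ≤ n := le_natDegree_of_ne_zero hkc
    refine (hmemS _).mpr ⟨by omega, by omega, ?_⟩
    rw [hrel k hkle]
    exact mul_ne_zero hε0 hkc
  have hleS : ∀ k ∈ S, k ≤ n := fun k hk => le_natDegree_of_ne_zero ((hmemS k).mp hk).2.2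
  obtain ⟨x, y, z, hxy, hxz, hyz, hSxyz⟩ := Finset.card_eq_three.mp hScard
  have hxS : x ∈ S := by rw [hSxyz]; simp
  have hyS : y ∈ S := by rw [hSxyz]; simp
  have hzS : z ∈ S := by rw [hSxyz]; simp
  -- the involution `k ↦ n - k` of the 3-set `S` has a fixed point `q`, and swaps the other two
  have hmem3 : ∀ k ∈ S, k = x ∨ k = y ∨ k = z := by
    intro k hk
    rw [hSxyz, Finset.mem_insert, Finset.mem_insert, Finset.mem_singleton] at hk
    exact hk
  have h1 := hmem3 _ (hsymm x hxS)
  have h2 := hmem3 _ (hsymm y hyS)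
  have h3 := hmem3 _ (hsymm z hzS)
  have hxn := hleS x hxS
  have hyn := hleS y hyS
  have hzn := hleS z hzS
  -- choose the fixed point `q` and the pair `p < r`
  obtain ⟨q, p, r, hqS, hpS, hrS, hq, hpr, hpq, hrq, hrp⟩ :
      ∃ q p r, q ∈ S ∧ p ∈ S ∧ r ∈ S ∧ n - q = q ∧ p < r ∧ p ≠ q ∧ r ≠ q ∧ n - p = r := by
    rcases h1 with h1 | h1 | h1
    · -- `x` fixed; `{y, z}` swapped
      rcases lt_or_gt_of_ne hyz with h | h
      · exact ⟨x, y, z, hxS, hyS, hzS, h1, h, fun e => hxy e.symm, fun e => hxz e.symm, by omega⟩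
      · exact ⟨x, z, y, hxS, hzS, hyS, h1, h, fun e => hxz e.symm, fun e => hxy e.symm, by omega⟩
    · -- `x ↔ y`, so `z` is fixed
      rcases lt_or_gt_of_ne hxy with h | h
      · exact ⟨z, x, y, hzS, hxS, hyS, by omega, h, hxz, hyz, h1⟩
      · exact ⟨z, y, x, hzS, hyS, hxS, by omega, h, hyz, hxz, by omega⟩
    · -- `x ↔ z`, so `y` is fixed
      rcases lt_or_gt_of_ne hxz with h | h
      · exact ⟨y, x, z, hyS, hxS, hzS, by omega, h, hxy, fun e => hyz e.symm, h1⟩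
      · exact ⟨y, z, x, hyS, hzS, hxS, by omega, h, fun e => hyz e.symm, hxy, by omega⟩
  obtain ⟨hq0, hqn, hqc⟩ := (hmemS q).mp hqS
  obtain ⟨hp0, hpn, hpc⟩ := (hmemS p).mp hpS
  obtain ⟨-, hrn, hrc⟩ := (hmemS r).mp hrS
  have hqle := hleS q hqS
  have hple := hleS p hpS
  have hn2 : n = 2 * q := by omega
  have hpq' : p < q := by omega
  -- `ε = 1`, from the middle coefficient
  have hε1 : ε = 1 := by
    rcases hε with h | h
    · exact h
    · exfalso
      have h2 := hrel q hqle
      rw [hq, h] at h2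
      have : P.coeff q = 0 := by linarith
      exact hqc this
  -- the other three members of `S` are `p, q, r` only
  have hSonly : ∀ k ∈ S, k = p ∨ k = q ∨ k = r := by
    intro k hk
    have := hmem3 k hk
    have hq3 := hmem3 q hqS
    have hp3 := hmem3 p hpS
    have hr3 := hmem3 r hrS
    omega
  refine ⟨q, q - p, P.coeff p, P.coeff q, by omega, by omega, hpc, hqc, hn2, ?_, ?_, rfl, ?_, ?_⟩
  · -- the explicit form
    have hcr : P.coeff r = P.coeff p := by
      have h := hrel p hple
      rw [hrp, hε1, one_mul] at h
      exact h
    have e1 : q + (q - p) = r := by omega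
    have e2 : q - (q - p) = p := by omega
    rw [e1, e2]
    ext k
    simp only [coeff_add, coeff_X_pow, coeff_C_mul, coeff_one]
    by_cases hk0 : k = 0
    · subst hk0
      rw [if_neg (by omega), if_neg (by omega), if_neg (by omega), if_neg (by omega), if_pos rfl, hc0, hε1]
      ring
    by_cases hkn : k = 2 * q
    · subst hkn
      rw [if_pos rfl, if_neg (by omega), if_neg (by omega), if_neg (by omega), if_neg (by omega), ← hn2, hcn]
      ring
    by_cases hkr : k = r
    · subst hkr
      rw [if_neg hkn, if_pos rfl, if_neg (by omega), if_neg (by omega), if_neg hk0, hcr]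
      ring
    by_cases hkq : k = q
    · subst hkq
      rw [if_neg hkn, if_neg (by omega), if_pos rfl, if_neg (by omega), if_neg hk0]
      ring
    by_cases hkp : k = p
    · subst hkp
      rw [if_neg hkn, if_neg (by omega), if_neg (by omega), if_pos rfl, if_neg hk0]
      ring
    rw [if_neg hkn, if_neg hkr, if_neg hkq, if_neg hkp, if_neg hk0]
    have : k ∉ S := fun hk => by rcases hSonly k hk with h | h | h <;> contradiction
    rw [hzero k this hk0 (by omega)]
    ring
  · have e2 : q - (q - p) = p := by omega
    rw [e2]
  · -- rank of `p = m - i` is `1` (only `0` lies below it)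
    have e2 : q - (q - p) = p := by omega
    rw [e2, Finset.card_eq_one]
    refine ⟨0, ?_⟩
    ext k
    simp only [Finset.mem_filter, mem_support_iff, Finset.mem_singleton]
    constructor
    · rintro ⟨hk, hkp⟩
      by_contra hk0
      have hkS : k ∈ S := (hmemS k).mpr ⟨hk0, by omega, hk⟩
      rcases hSonly k hkS with h | h | h <;> omega
    · rintro rfl
      exact ⟨by rw [hc0]; exact hε0, by omega⟩
  · -- rank of `q = m` is `2` (`0` and `p`)
    rw [Finset.card_eq_two]
    refine ⟨0, p, by omega, ?_⟩
    ext k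
    simp only [Finset.mem_filter, mem_support_iff, Finset.mem_insert, Finset.mem_singleton]
    constructor
    · rintro ⟨hk, hkq⟩
      by_cases hk0 : k = 0
      · exact Or.inl hk0
      · have hkS : k ∈ S := (hmemS k).mpr ⟨hk0, by omega, hk⟩
        rcases hSonly k hkS with h | h | h
        · exact Or.inr h
        · omega
        · omega
    · rintro (rfl | rfl)
      · exact ⟨by rw [hc0]; exact hε0, by omega⟩
      · exact ⟨hpc, hpq'⟩

/-- **The shape of a sub-Lehmer pentanomial.**  If `P ∈ ℤ[X]` has exactly five nonzero coefficients and
`1 < M(P) < M(ℓ)`, then `P = s · x^j · Q` with `s = ±1`, `Q = x^{2m} + a x^{m+i} + c x^m + a x^{m-i} + 1`,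
`0 < i < m`, `1 ≤ |a| ≤ 4`, `1 ≤ |c| ≤ 7`, and `Q` is sub-Lehmer too (`M(Q) = M(P)`). -/
theorem subLehmer_pentanomial_shape {P : ℤ[X]} (hP : SubLehmer P) (h5 : P.support.card = 5) :
    ∃ (s : ℤ) (j m i : ℕ) (a c : ℤ), (s = 1 ∨ s = -1) ∧ 0 < i ∧ i < m ∧ a ≠ 0 ∧ c ≠ 0 ∧ |a| ≤ 4 ∧ |c| ≤ 7 ∧
      SubLehmer (X ^ (2 * m) + C a * X ^ (m + i) + C c * X ^ m + C a * X ^ (m - i) + 1) ∧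
      P = C s * X ^ j * (X ^ (2 * m) + C a * X ^ (m + i) + C c * X ^ m + C a * X ^ (m - i) + 1) := by
  classical
  have hL := lehmer_measure_upper_bound
  have hP0 : P ≠ 0 := by
    intro h; have h1 := hP.1; rw [h] at h1
    unfold intMahlerMeasure at h1; simp at h1; linarith
  -- strip the power of `x`
  obtain ⟨P₀, hP₀, hndvd⟩ := exists_eq_pow_rootMultiplicity_mul_and_not_dvd P hP0 0
  rw [map_zero, sub_zero] at hP₀ hndvd
  set j := P.rootMultiplicity 0 with hj
  have hc0 : P₀.coeff 0 ≠ 0 := fun h => hndvd (X_dvd_iff.mpr h)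
  have hM : intMahlerMeasure P = intMahlerMeasure P₀ := by
    rw [hP₀, intMahlerMeasure_mul, intMahlerMeasure_X_pow, one_mul]
  have hcard₀ : P₀.support.card = 5 := by rw [← card_support_X_pow_mul P₀ j, ← hP₀]; exact h5
  have hsub₀ : SubLehmer P₀ := by unfold SubLehmer at hP ⊢; rwa [hM] at hP
  have hP₀0 : P₀ ≠ 0 := fun h => hc0 (by rw [h, coeff_zero])
  have hdpos : 0 < P₀.natDegree := by
    by_contra hd
    have hd0 : P₀.natDegree = 0 := by omega
    have hsmall : P₀.support.card ≤ 1 := by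
      rw [eq_C_of_natDegree_eq_zero hd0]
      by_cases h : P₀.coeff 0 = 0
      · simp [h]
      · rw [support_C h]; simp
    omega
  -- (anti)reciprocal in coefficient form
  have hrev := reverse_eq_or_of_subLehmer hsub₀ hc0
  obtain ⟨ε, hε, hrel⟩ : ∃ ε : ℤ, (ε = 1 ∨ ε = -1) ∧
      ∀ i ≤ P₀.natDegree, P₀.coeff (P₀.natDegree - i) = ε * P₀.coeff i := by
    rcases hrev with h | h
    · refine ⟨1, Or.inl rfl, fun i hi => ?_⟩
      have hc := congrArg (fun Q : ℤ[X] => Q.coeff i) h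
      simp only [coeff_reverse, revAt_le hi] at hc
      rw [hc, one_mul]
    · refine ⟨-1, Or.inr rfl, fun i hi => ?_⟩
      have hc := congrArg (fun Q : ℤ[X] => Q.coeff i) h
      simp only [coeff_reverse, revAt_le hi, coeff_neg] at hc
      rw [hc]; ring
  -- leading coefficient `± 1`, else `M ≥ 2`
  by_cases hlc : 2 ≤ |P₀.leadingCoeff|
  · exfalso
    have h := abs_leadingCoeff_le_intMahlerMeasure P₀
    have : (2 : ℝ) ≤ |(P₀.leadingCoeff : ℝ)| := by exact_mod_cast hlc
    linarith [hsub₀.2]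
  have hlc1 : P₀.leadingCoeff = 1 ∨ P₀.leadingCoeff = -1 := by
    have hne : P₀.leadingCoeff ≠ 0 := leadingCoeff_ne_zero.mpr hP₀0
    have hnn := abs_nonneg P₀.leadingCoeff
    rcases abs_choice P₀.leadingCoeff with h | h <;> rw [h] at hlc hnn <;> omega
  -- normalise the sign: `Q = s · P₀` monic
  obtain ⟨s, Q, hs, hQmon, hQ, hQdeg, hQrel, hQcard, hQsub⟩ : ∃ (s : ℤ) (Q : ℤ[X]), (s = 1 ∨ s = -1) ∧ Q.Monic ∧
      P₀ = C s * Q ∧ 0 < Q.natDegree ∧ (∀ i ≤ Q.natDegree, Q.coeff (Q.natDegree - i) = ε * Q.coeff i) ∧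
      Q.support.card = 5 ∧ SubLehmer Q := by
    rcases hlc1 with h1 | h1
    · exact ⟨1, P₀, Or.inl rfl, h1, by simp, hdpos, hrel, hcard₀, hsub₀⟩
    · refine ⟨-1, -P₀, Or.inr rfl, by rw [Monic, leadingCoeff_neg, h1, neg_neg], by simp,
        by rwa [natDegree_neg], ?_, by rwa [support_neg], ?_⟩
      · intro i hi
        rw [natDegree_neg] at hi ⊢
        rw [coeff_neg, coeff_neg, hrel i hi]; ring
      · unfold SubLehmer at hsub₀ ⊢; rwa [intMahlerMeasure_neg]
  obtain ⟨m, i, a, c, hi, him, ha, hc, -, hQeq, hQa, hQc, hr1, hr2⟩ :=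
    pentanomial_eq_of_monic_reciprocal hε hQmon hQdeg hQrel hQcard
  -- coefficient bounds (Akhtari–Vaaler via `FewnomialHeightBound`)
  have hmemp : m - i ∈ Q.support := by rw [mem_support_iff, hQa]; exact ha
  have ha4 : |a| ≤ 4 := by
    have h := natAbs_coeff_le_four_of_subLehmer hQsub hQcard.le hmemp (Or.inl hr1)
    rw [hQa] at h
    have : ((a.natAbs : ℕ) : ℤ) ≤ 4 := by exact_mod_cast h
    rwa [Int.natCast_natAbs] at this
  have hc7 : |c| ≤ 7 := by
    have h := natAbs_coeff_le_seven_of_subLehmer hQsub hQcard.le m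
    rw [hQc] at h
    have : ((c.natAbs : ℕ) : ℤ) ≤ 7 := by exact_mod_cast h
    rwa [Int.natCast_natAbs] at this
  refine ⟨s, j, m, i, a, c, hs, hi, him, ha, hc, ha4, hc7, by rw [← hQeq]; exact hQsub, ?_⟩
  rw [hP₀, hQ, hQeq, ← mul_assoc, mul_comm (X ^ j) (C s)]

end Summit.Ventures.DiscreteObjects.Mahler
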